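import Summits.NavierStokesRegularity.FunctionalMining.VelocityMomentBalance
import Summits.NavierStokesRegularity.FunctionalMining.VelocityMomentProduction
import Summits.NavierStokesRegularity.FunctionalMining.VorticityMomentSaturatingLaw
import Summits.NavierStokesRegularity.FunctionalMining.SaturatingLawLyapunov
import HarnessLib

/-!
# FunctionalMining — K0 row `EV.s|T_LD|G1` for every real `4 < s < 6` (kernel): `s = 9/2`

Search for candidate a priori estimates; no regularity claim. Cell `pub-nsfunc`, prove seat
(gen 10). SIEVELD §3.5 (Theorem G for the velocity moments `U_s = ∫|u|^s`): for every real
`4 < s < 6` there is `κ` with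

`dU_s/dt ≤ κ · ν^{−(2s−3)/(s−3)} · ‖∇u‖₂² · U_s^{1+1/(s−3)}`

along every zero-mean classical solution of unforced Navier–Stokes on `T³` — the cell's saturating
law `T_LD` (`Candidates.SaturatingLaw`) for `v ↦ ∫‖v‖^s` with `σ = s − 3`, `γ = (2s−3)/(s−3)`.
The rows `s = 4` (`σ = 1`, `γ = 5`) and `s = 6` (`σ = 3`, `γ = 3`) are the tree theorems
`VelocityL4.velocityL4_saturatingLaw`, `VelocityL6.velocityL6_saturatingLaw`; the open interval
covers the remaining matrix row `EV.s=9/2|T_LD|G1` (`σ = 3/2`, `γ = 4`), filed literally. Assembly: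

* slice form of the exact balance (`VelocityMoment.derivWithin_Us_le`, `C¹` weight `r^{s/2}`,
  viscous sign at a real exponent): `U̇_s ≤ −sνI − sX`, `I = ∫‖u‖^{s−2}∑ₖ‖∂ₖu‖²`,
  `X = ∫(|u|²)^{s/2−1}⟪u, ∇p⟫`;
* static bound `|X| ≤ K₀ I^e (Z U_s^{1+1/σ})^{1−e}`, `e = (2s−3)/(3s−6)`
  (`VelocityMoment.production_rpow_bookkeeping` with the Cauchy–Schwarz, pressure Calderón–Zygmund,
  Hölder, Sobolev and top-node inputs of `VelocityMomentProduction` and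
  `NonlinearPoincare.integral_norm_rpow_top_le` at `a = (s−2)/2`);
* Young at the weights `(e, 1−e)` (`VorticityMoment.young_rpow`): `e/(1−e) = γ`.

Also the Lyapunov rows `EK.EV.s|T_M0` (`SaturatingLaw.antitoneOn_lyapunov`), literally `s = 9/2`.
Existential constants; a priori inequalities along smooth solutions, small-data closing only.
-/

noncomputable section

open MeasureTheory Finset Set Filter Topology
open scoped InnerProductSpace RealInnerProductSpace ContDiff

namespace Summit.NavierStokesRegularity.FunctionalMining

open Literature.Analysis.FunctionSpaces Literature.Analysis.FunctionSpaces.Torus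
  Literature.Analysis.FluidPDE

namespace VelocityMoment

open VelocityL4 NonlinearPoincare

variable {d : Type*} [Fintype d] [DecidableEq d]

/-! ## 1. The static production bound along a solution -/

/-- **Static production bound for `U_s`, real `4 < s < 6`, along a solution on `T^d`, `#d = 3`.**
With the constants of the mean-zero Sobolev embedding (`C₆`), the pressure-gradient Calderón–Zygmund
bound at `r = 2` (`C_p`) and the top node (`C_T`): at every time of the window,
`|∫(|u|²)^{s/2−1}⟪u, ∇p⟫| ≤ C_p C₆^{w/6} C_T^{(1−w)/6} I^e (‖∇u‖₂² U_s^{1+1/(s−3)})^{1−e}`. [ours] -/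
theorem pressure_production_rpow_le {C₆ Cp CT s : ℝ} (hC₆0 : 0 ≤ C₆) (hCp0 : 0 ≤ Cp)
    (hCT0 : 0 ≤ CT) (hs4 : 4 < s) (hs6 : s < 6)
    (hC₆ : ∀ w : UnitAddTorus d → EuclideanSpace ℝ d, IsSmooth w → HasZeroMean w →
      ∫ x, ‖w x‖ ^ 6 ≤ C₆ * gradNormSq w ^ 3)
    (hCT : ∀ w : UnitAddTorus d → EuclideanSpace ℝ d, IsSmooth w → HasZeroMean w →
      ∫ x, ‖w x‖ ^ (3 * s) ≤ CT * (∫ x, ‖w x‖ ^ (s - 2) * ∑ k, ‖partialDeriv k w x‖ ^ 2) ^ 3)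
    {a b ν : ℝ} {u : ℝ → UnitAddTorus d → EuclideanSpace ℝ d} {p : ℝ → UnitAddTorus d → ℝ}
    (hsol : IsClassicalNSSolutionOn (Icc a b) ν 0 u p)
    (hmean : ∀ t ∈ Icc a b, HasZeroMean (u t))
    (hCp : ∀ t ∈ Icc a b, (∫ x, ‖gradient (p t) x‖ ^ (2 : ℝ)) ^ (1 / (2 : ℝ)) ≤
      Cp * (∫ x, ‖convect (u t) (u t) x‖ ^ (2 : ℝ)) ^ (1 / (2 : ℝ)))
    {t : ℝ} (ht : t ∈ Icc a b) :
    |∫ x, (‖u t x‖ ^ 2) ^ (s / 2 - 1) * ⟪u t x, gradient (p t) x⟫| ≤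
      Cp * C₆ ^ ((6 - s) / (3 * s - 6) / 6) * CT ^ ((1 - (6 - s) / (3 * s - 6)) / 6) *
        (∫ x, ‖u t x‖ ^ (s - 2) * ∑ k, ‖partialDeriv k (u t) x‖ ^ 2) ^ ((2 * s - 3) / (3 * s - 6)) *
        (gradNormSq (u t) * (∫ x, ‖u t x‖ ^ s) ^ (1 + (s - 3)⁻¹)) ^
          (1 - (2 * s - 3) / (3 * s - 6)) := by
  have hut : IsSmooth (u t) := hsol.smooth_velocity.isSmooth_slice ht
  have hpt : IsSmooth (p t) := hsol.smooth_pressure.isSmooth_slice ht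
  have h0 : HasZeroMean (u t) := hmean t ht
  have huc : Continuous (u t) := hut.continuous
  have hg0 : ∀ x, 0 ≤ ∑ k, ‖partialDeriv k (u t) x‖ ^ 2 := fun x =>
    Finset.sum_nonneg fun k _ => sq_nonneg _
  -- the quantities
  obtain ⟨X, hX⟩ : ∃ X : ℝ, X = ∫ x, (‖u t x‖ ^ 2) ^ (s / 2 - 1) * ⟪u t x, gradient (p t) x⟫ :=
    ⟨_, rfl⟩
  obtain ⟨N, hN⟩ : ∃ N : ℝ, N = ∫ x, ‖u t x‖ ^ (s - 1) * ‖gradient (p t) x‖ := ⟨_, rfl⟩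
  obtain ⟨A, hA⟩ : ∃ A : ℝ, A = ∫ x, ‖u t x‖ ^ (2 * s - 2) := ⟨_, rfl⟩
  obtain ⟨P, hP⟩ : ∃ P : ℝ, P = ∫ x, ‖gradient (p t) x‖ ^ 2 := ⟨_, rfl⟩
  obtain ⟨J, hJ⟩ : ∃ J : ℝ, J = ∫ x, ‖u t x‖ ^ 2 * ∑ k, ‖partialDeriv k (u t) x‖ ^ 2 := ⟨_, rfl⟩
  obtain ⟨I, hI⟩ : ∃ I : ℝ, I = ∫ x, ‖u t x‖ ^ (s - 2) * ∑ k, ‖partialDeriv k (u t) x‖ ^ 2 :=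
    ⟨_, rfl⟩
  obtain ⟨Z, hZ⟩ : ∃ Z : ℝ, Z = gradNormSq (u t) := ⟨_, rfl⟩
  obtain ⟨U, hU⟩ : ∃ U : ℝ, U = ∫ x, ‖u t x‖ ^ s := ⟨_, rfl⟩
  obtain ⟨B, hB⟩ : ∃ B : ℝ, B = ∫ x, ‖u t x‖ ^ (4 * s - 6) := ⟨_, rfl⟩
  obtain ⟨S₆, hS⟩ : ∃ S : ℝ, S = ∫ x, ‖u t x‖ ^ (6 : ℝ) := ⟨_, rfl⟩
  obtain ⟨T, hT⟩ : ∃ T : ℝ, T = ∫ x, ‖u t x‖ ^ (3 * s) := ⟨_, rfl⟩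
  rw [← hX, ← hI, ← hZ, ← hU]
  have hP0 : 0 ≤ P := by rw [hP]; exact integral_nonneg fun x => sq_nonneg _
  have hJ0 : 0 ≤ J := by rw [hJ]; exact integral_nonneg fun x => mul_nonneg (sq_nonneg _) (hg0 x)
  have hI0 : 0 ≤ I := by
    rw [hI]; exact integral_nonneg fun x => mul_nonneg (Real.rpow_nonneg (norm_nonneg _) _) (hg0 x)
  have hZ0 : 0 ≤ Z := by rw [hZ]; exact gradNormSq_nonneg _
  have hU0 : 0 ≤ U := by rw [hU]; exact integral_nonneg fun x => Real.rpow_nonneg (norm_nonneg _) _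
  have hB0 : 0 ≤ B := by rw [hB]; exact integral_nonneg fun x => Real.rpow_nonneg (norm_nonneg _) _
  have hS0 : 0 ≤ S₆ := by rw [hS]; exact integral_nonneg fun x => Real.rpow_nonneg (norm_nonneg _) _
  have hT0 : 0 ≤ T := by rw [hT]; exact integral_nonneg fun x => Real.rpow_nonneg (norm_nonneg _) _
  -- the seven inputs
  have h1 : X ^ 2 ≤ A * P := by
    have ha := abs_pressure_production_le hut hpt (s := s) (by linarith)
    have hb := sq_integral_production_le hut hpt (s := s) (by linarith)
    rw [← hX, ← hN] at ha
    rw [← hN, ← hA, ← hP] at hb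
    have hN0 : 0 ≤ N := (abs_nonneg X).trans ha
    calc X ^ 2 = |X| ^ 2 := (sq_abs X).symm
      _ ≤ N ^ 2 := pow_le_pow_left₀ (abs_nonneg X) ha 2
      _ ≤ A * P := hb
  have h2 : P ≤ Cp ^ 2 * J := by
    rw [hP, hJ]; exact integral_gradPressure_sq_le hut (hCp t ht)
  have h3 : J ≤ I ^ (2 / (s - 2)) * Z ^ (1 - 2 / (s - 2)) := by
    rw [hJ, hI, hZ, gradNormSq]; exact integral_normSq_mul_gradSq_le hut hs4
  have h4 : A ≤ U ^ (2 / 3 : ℝ) * B ^ (1 / 3 : ℝ) := by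
    rw [hA, hU, hB]; exact integral_norm_rpow_two_s_le huc (by linarith)
  have h5 : B ≤ S₆ ^ ((6 - s) / (3 * s - 6)) * T ^ (1 - (6 - s) / (3 * s - 6)) := by
    rw [hB, hS, hT]; exact integral_norm_rpow_four_s_le huc (by linarith) hs6
  have h6 : S₆ ≤ C₆ * Z ^ 3 := by
    have h := hC₆ (u t) hut h0
    rw [hS, hZ]
    have e : ∫ x, ‖u t x‖ ^ (6 : ℝ) = ∫ x, ‖u t x‖ ^ 6 :=
      integral_congr_ae (ae_of_all _ fun x => by
        show ‖u t x‖ ^ (6 : ℝ) = ‖u t x‖ ^ 6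
        rw [show (6 : ℝ) = ((6 : ℕ) : ℝ) by norm_num, Real.rpow_natCast])
    rw [e]; exact h
  have h7 : T ≤ CT * I ^ 3 := by rw [hT, hI]; exact hCT (u t) hut h0
  exact production_rpow_bookkeeping hs4 hs6 hP0 hJ0 hI0 hZ0 hU0 hB0 hS0 hT0 hCp0 hC₆0 hCT0
    h1 h2 h3 h4 h5 h6 h7

/-! ## 2. The saturating law for real `4 < s < 6` -/

/-- **K0 rows `EV.s|T_LD|G1` HOLD (∃κ) for every real `4 < s < 6`, in the kernel.** There is a
constant `κ` such that on `T^d` with `#d = 3`, along every zero-mean classical solution of the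
unforced Navier–Stokes equations (`ν > 0`), at every time of the window, `r ↦ ∫‖u(r)‖^s` is
differentiable within the window and
`d/dt ∫‖u‖^s ≤ κ · ν^{−(2s−3)/(s−3)} · ‖∇u‖₂² · (∫‖u‖^s)^{1+1/(s−3)}` — the cell's saturating law
`T_LD` with `σ = s − 3`, `γ = (2s−3)/(s−3)` for the velocity moment `U_s` (`Candidates.SaturatingLaw`).
Existential constant (mean-zero Sobolev, pressure Calderón–Zygmund at `r = 2`, top node); an a
priori inequality, small-data closing only. [ours; SIEVELD §3.5 with tree inputs, cf.
RobinsonRodrigoSadowski2016 Ex. 11.4] -/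
theorem velocityMoment_saturatingLaw {s : ℝ} (hs4 : 4 < s) (hs6 : s < 6) :
    ∃ κ : ℝ, SaturatingLaw (d := d) (fun v => ∫ x, ‖v x‖ ^ s) (s - 3) ((2 * s - 3) / (s - 3)) κ := by
  classical
  by_cases hd : Fintype.card d = 3
  swap
  · exact ⟨0, fun h => absurd h hd⟩
  haveI : Nonempty d := Fintype.card_pos_iff.mp (by omega)
  obtain ⟨C₆, hC₆0, hC₆⟩ := Torus.exists_integral_norm_pow_six_le_gradNormSq_cube (d := d) hd
  obtain ⟨Cp, hCp0, hCp⟩ := Torus.exists_gradPressure_Ls_le_convect (d := d) (r := 2) one_lt_two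
  have ha : 0 < (s - 2) / 2 := by linarith
  obtain ⟨CT, hCT⟩ : ∃ C : ℝ, C = 32 * (C₆ * (1 + (s - 2) / 2) ^ 6 +
      (6 * (1 + ((3 : ℝ) ^ (1 + (s - 2) / 2)) ^ 2) * (1 + (s - 2) / 2) ^ 2 *
        (Fintype.card d : ℝ) ^ 3) ^ 3) := ⟨_, rfl⟩
  have hCT0 : 0 ≤ CT := by rw [hCT]; positivity
  have hCT' : ∀ w : UnitAddTorus d → EuclideanSpace ℝ d, IsSmooth w → HasZeroMean w →
      ∫ x, ‖w x‖ ^ (3 * s) ≤ CT * (∫ x, ‖w x‖ ^ (s - 2) * ∑ k, ‖partialDeriv k w x‖ ^ 2) ^ 3 := by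
    intro w hw hw0
    have h := integral_norm_rpow_top_le hC₆0 hC₆ hw hw0 ha
    rw [show 6 * ((s - 2) / 2) + 6 = 3 * s by ring, show 2 * ((s - 2) / 2) = s - 2 by ring,
      ← hCT] at h
    exact h
  -- the exponent `e = γ/(1+γ)` and the static constant
  obtain ⟨e, he⟩ : ∃ e : ℝ, e = (2 * s - 3) / (3 * s - 6) := ⟨_, rfl⟩
  obtain ⟨K₀, hK₀⟩ : ∃ K : ℝ, K = Cp * C₆ ^ ((6 - s) / (3 * s - 6) / 6) *
      CT ^ ((1 - (6 - s) / (3 * s - 6)) / 6) := ⟨_, rfl⟩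
  have h36 : 0 < 3 * s - 6 := by linarith
  have hs3 : 0 < s - 3 := by linarith
  have he0 : 0 < e := by rw [he]; exact div_pos (by linarith) h36
  have he1 : e < 1 := by rw [he, div_lt_one h36]; linarith
  have h1e : 1 - e = (s - 3) / (3 * s - 6) := by
    rw [he, one_sub_div h36.ne']; congr 1; ring
  have hγ : e / (1 - e) = (2 * s - 3) / (s - 3) := by
    rw [h1e, he, div_div_div_cancel_right₀ h36.ne']
  have hK₀0 : 0 ≤ K₀ := by rw [hK₀]; positivity
  refine ⟨s * K₀ ^ (1 / (1 - e)), ?_⟩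
  intro _ ν hν a b hab u p hsol hmean t ht
  have hut : IsSmooth (u t) := hsol.smooth_velocity.isSmooth_slice ht
  -- the functional in the balance's spelling `∫ (‖u‖²)^{s/2}`
  have hF : (fun r => ∫ x, ‖u r x‖ ^ s) = fun r => ∫ x, (‖u r x‖ ^ 2) ^ (s / 2) := by
    funext r
    exact integral_congr_ae (ae_of_all _ fun x => by
      show ‖u r x‖ ^ s = (‖u r x‖ ^ 2) ^ (s / 2)
      rw [normSq_rpow_eq]; congr 1; ring)
  obtain ⟨hdiff, hle⟩ := derivWithin_Us_le hab hν.le hsol (by linarith : 2 < s) ht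
  refine ⟨by rw [hF]; exact hdiff, ?_⟩
  rw [hF]
  show _ ≤ s * K₀ ^ (1 / (1 - e)) * ν ^ (-((2 * s - 3) / (s - 3))) *
      (2 * torusEnstrophy (u t)) * (∫ x, ‖u t x‖ ^ s) ^ (1 + (s - 3)⁻¹)
  -- opaque names for the slice quantities
  obtain ⟨X, hX⟩ : ∃ X : ℝ, X = ∫ x, (‖u t x‖ ^ 2) ^ (s / 2 - 1) * ⟪u t x, gradient (p t) x⟫ :=
    ⟨_, rfl⟩
  obtain ⟨I', hI'⟩ : ∃ I : ℝ, I = ∫ x, (‖u t x‖ ^ 2) ^ (s / 2 - 1) *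
      ∑ k, ‖partialDeriv k (u t) x‖ ^ 2 := ⟨_, rfl⟩
  obtain ⟨I, hI⟩ : ∃ I : ℝ, I = ∫ x, ‖u t x‖ ^ (s - 2) * ∑ k, ‖partialDeriv k (u t) x‖ ^ 2 :=
    ⟨_, rfl⟩
  obtain ⟨Z, hZ⟩ : ∃ Z : ℝ, Z = gradNormSq (u t) := ⟨_, rfl⟩
  obtain ⟨U, hU⟩ : ∃ U : ℝ, U = ∫ x, ‖u t x‖ ^ s := ⟨_, rfl⟩
  obtain ⟨M, hM⟩ : ∃ M : ℝ, M = Z * U ^ (1 + (s - 3)⁻¹) := ⟨_, rfl⟩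
  have hII : I' = I := by
    rw [hI', hI]
    exact integral_congr_ae (ae_of_all _ fun x => by
      show (‖u t x‖ ^ 2) ^ (s / 2 - 1) * _ = ‖u t x‖ ^ (s - 2) * _
      rw [normSq_rpow_eq, show 2 * (s / 2 - 1) = s - 2 by ring])
  rw [← hX, ← hI', hII] at hle
  have hg0 : ∀ x, 0 ≤ ∑ k, ‖partialDeriv k (u t) x‖ ^ 2 := fun x =>
    Finset.sum_nonneg fun k _ => sq_nonneg _
  have hI0 : 0 ≤ I := by
    rw [hI]; exact integral_nonneg fun x => mul_nonneg (Real.rpow_nonneg (norm_nonneg _) _) (hg0 x)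
  have hZ0 : 0 ≤ Z := by rw [hZ]; exact gradNormSq_nonneg _
  have hU0 : 0 ≤ U := by rw [hU]; exact integral_nonneg fun x => Real.rpow_nonneg (norm_nonneg _) _
  have hM0 : 0 ≤ M := by rw [hM]; exact mul_nonneg hZ0 (Real.rpow_nonneg hU0 _)
  -- the static bound `|X| ≤ K₀ I^e M^{1-e}`
  have hstat : |X| ≤ K₀ * I ^ e * M ^ (1 - e) := by
    have h := pressure_production_rpow_le hC₆0 hCp0 hCT0 hs4 hs6 hC₆ hCT' hsol hmean
      (fun r hr => hCp hab hsol r hr) ht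
    rw [← hX, ← hI, ← hZ, ← hU, ← he, ← hM, ← hK₀] at h
    exact h
  -- Young
  have hY := VorticityMoment.young_rpow he0 he1 hK₀0 hI0 hM0 hν
  -- the budget in closed form
  have hbudget : s * K₀ ^ (1 / (1 - e)) * ν ^ (-((2 * s - 3) / (s - 3))) *
      (2 * torusEnstrophy (u t)) * (∫ x, ‖u t x‖ ^ s) ^ (1 + (s - 3)⁻¹) =
      s * (K₀ ^ (1 / (1 - e)) * ν ^ (-(e / (1 - e))) * M) := by
    have e1 : 2 * torusEnstrophy (u t) = Z := by rw [hZ, torusEnstrophy]; ring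
    rw [e1, ← hU, hγ, hM]
    ring
  rw [hbudget]
  have hXle : -X ≤ |X| := neg_le_abs X
  have hs0 : 0 ≤ s := by linarith
  have h1 : -(s * ν * I) - s * X ≤ s * (K₀ ^ (1 / (1 - e)) * ν ^ (-(e / (1 - e))) * M) := by
    have := mul_le_mul_of_nonneg_left (hXle.trans (hstat.trans hY)) hs0
    linarith
  exact hle.trans h1

/-! ## 3. The matrix row `s = 9/2` -/

/-- **Row `EV.s=9/2|T_LD|G1` (kernel):** `∃ κ, SaturatingLaw (v ↦ ∫‖v‖^{9/2}) (3/2) 4 κ` on `T³` —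
`d/dt ∫|u|^{9/2} ≤ κ ν^{−4} ‖∇u‖₂² (∫|u|^{9/2})^{5/3}`. [ours] -/
theorem velocityMoment_saturatingLaw_nine_halves :
    ∃ κ : ℝ, SaturatingLaw (d := d) (fun v => ∫ x, ‖v x‖ ^ (9 / 2 : ℝ)) (3 / 2) 4 κ := by
  obtain ⟨κ, hκ⟩ := velocityMoment_saturatingLaw (d := d) (s := 9 / 2) (by norm_num) (by norm_num)
  have e1 : (9 / 2 : ℝ) - 3 = 3 / 2 := by norm_num
  have e2 : ((2 : ℝ) * (9 / 2) - 3) / (9 / 2 - 3) = 4 := by norm_num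
  rw [e2, e1] at hκ
  exact ⟨κ, hκ⟩

/-! ## 4. The Lyapunov rows `EK.EV.s|T_M0` -/

/-- **Rows `EK.EV.s|T_M0` for real `4 < s < 6` (kernel), on `T³`.** There is `κ > 0` such that
along every zero-mean classical solution of unforced Navier–Stokes on `T³ × [a, b]` with
`∫‖u t‖^s > 0` on the window,
`t ↦ K(u t) − ((s−3)/κ) ν^{(2s−3)/(s−3)+1} (∫‖u t‖^s)^{−1/(s−3)}` is antitone. [folklore] -/
theorem velocityMoment_lyapunov_antitoneOn {s : ℝ} (hs4 : 4 < s) (hs6 : s < 6) :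
    ∃ κ : ℝ, 0 < κ ∧ ∀ {ν a b : ℝ}, 0 < ν → a < b →
      ∀ {u : ℝ → UnitAddTorus (Fin 3) → EuclideanSpace ℝ (Fin 3)}
        {p : ℝ → UnitAddTorus (Fin 3) → ℝ},
        Torus.IsClassicalNSSolutionOn (Icc a b) ν 0 u p →
        (∀ t ∈ Icc a b, Torus.HasZeroMean (u t)) →
        (∀ t ∈ Icc a b, 0 < ∫ x, ‖u t x‖ ^ s) →
        AntitoneOn (fun t => Torus.kineticEnergy (u t) -
            (s - 3) / κ * ν ^ ((2 * s - 3) / (s - 3) + 1) *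
              (∫ x, ‖u t x‖ ^ s) ^ (-(s - 3)⁻¹)) (Icc a b) := by
  obtain ⟨κ₀, hκ₀⟩ := velocityMoment_saturatingLaw (d := Fin 3) hs4 hs6
  have hF0 : ∀ v : UnitAddTorus (Fin 3) → EuclideanSpace ℝ (Fin 3), 0 ≤ ∫ x, ‖v x‖ ^ s :=
    fun v => integral_nonneg fun x => Real.rpow_nonneg (norm_nonneg _) _
  have hlaw := hκ₀.mono_kappa hF0 (le_max_left κ₀ 1)
  have hκ : 0 < max κ₀ 1 := lt_of_lt_of_le one_pos (le_max_right _ _)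
  refine ⟨max κ₀ 1, hκ, fun hν hab u p hsol hmean hpos => ?_⟩
  exact hlaw.antitoneOn_lyapunov (by linarith) hκ (by simp) hν hab hsol hmean hpos

/-- **Row `EK.EV.s=9/2|T_M0` (kernel):** `∃ κ > 0`, `K − (3/(2κ)) ν⁵ (∫‖u‖^{9/2})^{−2/3}` antitone on
positive windows of zero-mean classical solutions on `T³`. [ours] -/
theorem velocityMoment_lyapunov_nine_halves :
    ∃ κ : ℝ, 0 < κ ∧ ∀ {ν a b : ℝ}, 0 < ν → a < b →
      ∀ {u : ℝ → UnitAddTorus (Fin 3) → EuclideanSpace ℝ (Fin 3)}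
        {p : ℝ → UnitAddTorus (Fin 3) → ℝ},
        Torus.IsClassicalNSSolutionOn (Icc a b) ν 0 u p →
        (∀ t ∈ Icc a b, Torus.HasZeroMean (u t)) →
        (∀ t ∈ Icc a b, 0 < ∫ x, ‖u t x‖ ^ (9 / 2 : ℝ)) →
        AntitoneOn (fun t => Torus.kineticEnergy (u t) -
            (3 / 2) / κ * ν ^ (5 : ℝ) * (∫ x, ‖u t x‖ ^ (9 / 2 : ℝ)) ^ (-(2 / 3 : ℝ))) (Icc a b) := by
  obtain ⟨κ, hκ, h⟩ := velocityMoment_lyapunov_antitoneOn (s := 9 / 2) (by norm_num) (by norm_num)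
  refine ⟨κ, hκ, fun hν hab u p hsol hmean hpos => ?_⟩
  have h' := h hν hab hsol hmean hpos
  refine h'.congr fun t _ => ?_
  norm_num

end VelocityMoment

end Summit.NavierStokesRegularity.FunctionalMining
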